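import Summits.CriticalPhenomena.CardyFormulaZ2.Theorems.CardyBoundaryCoulombGasHalfPlaneMarkDensityLawReduction
import Summits.CriticalPhenomena.CardyFormulaZ2.Theorems.CardyBoundaryCoulombGasHalfPlaneMarkDensityLawBoxExhaustion

/-!
# Line `Sketch` — crux 5 from crux 4: `RectilinearCardy → HalfPlaneMarkDensityLaw`
# (stmt-CriticalPhenomena-5661 ⟸ stmt-CriticalPhenomena-5660, route CardyBoundaryCoulombGas)

Composition of the two landed halves of the line: box exhaustion
(`collinearCardy_of_rectilinearCardy : RectilinearCardy → C⁺`, Cardy for the Schwarz–Christoffel boxes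
with four collinear bottom marks + RSW one-arm truncation + shrinking-mark asymptotics of `sn`) and the
reduction (`stub_reduction : C⁺ → HalfPlaneMarkDensityLaw`, translation + telescoping + four-case
inclusion + independence + two-arm point bound + difference quotient).  So item 5 of the route closes the
moment its sibling crux RectilinearCardy (stmt-CriticalPhenomena-5660) does (registered extra stub
`stub_fromRectilinear`; a CONDITIONAL result — the item itself stays open, blocked on stmt-5660).
-/

noncomputable section

namespace Summit.CriticalPhenomena.CardyFormulaZ2.Cruxes.HalfPlaneMarkDensityLaw.SketchLine

open Summit.CriticalPhenomena.CardyFormulaZ2.Theses.CardyBoundaryCoulombGas (HalfPlaneMarkDensityLaw RectilinearCardy)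

/-- **Crux 4 ⇒ crux 5**: `RectilinearCardy → HalfPlaneMarkDensityLaw` (registered extra stub
`stub_fromRectilinear` of line `Sketch`). [folklore] -/
theorem stub_fromRectilinear :
    Summit.CriticalPhenomena.CardyFormulaZ2.Theses.CardyBoundaryCoulombGas.RectilinearCardy →
      Summit.CriticalPhenomena.CardyFormulaZ2.Theses.CardyBoundaryCoulombGas.HalfPlaneMarkDensityLaw :=
  fun h ↦ stub_reduction (collinearCardy_of_rectilinearCardy h)

end Summit.CriticalPhenomena.CardyFormulaZ2.Cruxes.HalfPlaneMarkDensityLaw.SketchLine
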